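import Summits.CriticalPhenomena.PercolationContinuityZ3.Theorems.FK.UniquenessInfiniteClusterFKTheta
import Summits.CriticalPhenomena.PercolationContinuityZ3.Theorems.FK.InfiniteVolumeDLR
import HarnessLib

/-!
# FK-continuity transplant, FO-08 (canonical leaf): uniqueness of the infinite cluster for
# `rcLimit d b p q`, unconditionally

Cell `fk-continuity` (bschramm), row FO-08; support file for the FK-continuity transplant
(`--supports stmt-CriticalPhenomena-4575`); builds on p205010 (kernel theorem, internal audit signed;
external expert review pending).

`UniquenessInfiniteClusterFK.lean` / `UniquenessInfiniteClusterFKTheta.lean` state the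
0/1-infinite-cluster property of a box limit `P = φ^b_{p,q}` and its consequences under the DLR
sandwich hypothesis `hG : FKGibbs d p q P`. Row FO-06a-2 (`InfiniteVolumeDLR.lean`,
`IsBoxLimit.fkGibbs`) discharges `hG` for every box limit, so here everything is unconditional, for
every box limit and for the canonical measures `rcLimit d b p q` of `InfiniteVolumeDefs.lean`:

* `IsBoxLimit.isInsertionTolerantErgodic'`, `IsBoxLimit.ae_numInfiniteClusters_le_one'` — the
  hypothesis-free forms for an arbitrary box limit;
* `isInsertionTolerantErgodic_rcLimit`, **`ae_numInfiniteClusters_le_one_rcLimit`** (Grimmett 2006,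
  Thm. (4.33)(c): `φ^b_{p,q}`-a.s. at most one infinite cluster, all `d`, `0 ≤ p ≤ 1`, `q ≥ 1`, both
  `b`), **`rcLimit_false/true_exactlyOneInfCluster_eq_one`** (Thm. (5.99) with `θ⁰/θ¹`),
  `thetaFree/thetaWired_sq_le_rcLimit_real_openConn` ((5.32) lower bound),
  `rcBoxLaw_real_openConn_tendsto_rcLimit` (Prop. (5.12)), `rcLimit_tendsto_real_openConn_cofinite`
  ((5.32): `φ^b_{p,q}(0 ↔ u) → θ^b(p,q)²`).

## References

* G. Grimmett, *The Random-Cluster Model*, Springer 2006, Thm. (4.33)(c), Prop. (5.12), (5.32),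
  Thm. (5.99). [Grimmett2006]
-/

noncomputable section

open MeasureTheory Set Filter
open scoped ENNReal Topology

namespace Summit.CriticalPhenomena.PercolationContinuityZ3.Theorems.FK

open Literature.Probability.Percolation Literature.Probability.LatticeModels
open Literature.Barriers.CriticalPhenomena (thetaWired)

variable {d : ℕ} {b : Bool} {p q : ℝ} {P : Measure (BondConfig (Site d))}

/-! ### Hypothesis-free forms for an arbitrary box limit -/

/-- `φ^b_{p,q}` is translation invariant, ergodic on invariant events and insertion tolerant
(`0 < p ≤ 1`, `q ≥ 1`), the DLR sandwich being supplied by `IsBoxLimit.fkGibbs`.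
[cite: Grimmett2006, Thm. (4.33)(c) p. 79] -/
theorem IsBoxLimit.isInsertionTolerantErgodic' (hP : IsBoxLimit d b p q P) (hp : p ∈ Set.Ioc (0 : ℝ) 1)
    (hq : 1 ≤ q) : IsInsertionTolerantErgodic P :=
  hP.isInsertionTolerantErgodic (hP.fkGibbs ⟨hp.1.le, hp.2⟩ hq) hp hq

/-- **Grimmett 2006, Thm. (4.33)(c), hypothesis-free**: every box limit `φ^b_{p,q}` (`0 ≤ p ≤ 1`,
`q ≥ 1`) has almost surely at most one infinite cluster. [cite: Grimmett2006, Thm. (4.33)(c) p. 79] -/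
theorem IsBoxLimit.ae_numInfiniteClusters_le_one' (hP : IsBoxLimit d b p q P)
    (hp : p ∈ Set.Icc (0 : ℝ) 1) (hq : 1 ≤ q) : ∀ᵐ ω ∂P, numInfiniteClusters ω ≤ 1 :=
  hP.ae_numInfiniteClusters_le_one (hP.fkGibbs hp hq) hp hq

/-! ### The canonical measures `rcLimit d b p q` -/

/-- `rcLimit d b p q` is translation invariant, ergodic on invariant events and insertion tolerant
(`0 < p ≤ 1`, `q ≥ 1`). [cite: Grimmett2006, Thm. (4.33)(c) p. 79] -/
theorem isInsertionTolerantErgodic_rcLimit (b : Bool) {p q : ℝ} (hp : p ∈ Set.Ioc (0 : ℝ) 1)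
    (hq : 1 ≤ q) : IsInsertionTolerantErgodic (rcLimit d b p q) :=
  (isBoxLimit_rcLimit b ⟨hp.1.le, hp.2⟩ hq).isInsertionTolerantErgodic' hp hq

/-- **Grimmett 2006, Thm. (4.33)(c) for `rcLimit d b p q`**: almost surely at most one infinite
cluster (`0 ≤ p ≤ 1`, `q ≥ 1`, both boundary conditions, every `d`). [cite: Grimmett2006, Thm. (4.33)(c) p. 79] -/
theorem ae_numInfiniteClusters_le_one_rcLimit (b : Bool) {p q : ℝ} (hp : p ∈ Set.Icc (0 : ℝ) 1)
    (hq : 1 ≤ q) : ∀ᵐ ω ∂(rcLimit d b p q), numInfiniteClusters ω ≤ 1 :=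
  (isBoxLimit_rcLimit b hp hq).ae_numInfiniteClusters_le_one' hp hq

/-- **Grimmett 2006, Thm. (5.99), `b = 0`**: `φ⁰_{p,q}(I = 1) = 1` whenever `θ⁰(p,q) > 0`. [cite: Grimmett2006, Thm. (5.99) p. 122] -/
theorem rcLimit_false_exactlyOneInfCluster_eq_one (hp : p ∈ Set.Icc (0 : ℝ) 1) (hq : 1 ≤ q)
    (hθ : 0 < thetaFree d p q) : rcLimit d false p q (exactlyOneInfCluster (Site d)) = 1 :=
  (isBoxLimit_rcLimit false hp hq).measure_exactlyOneInfCluster_eq_one_of_thetaFree_pos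
    ((isBoxLimit_rcLimit false hp hq).fkGibbs hp hq) hp hq hθ

/-- **Grimmett 2006, Thm. (5.99), `b = 1`**: `φ¹_{p,q}(I = 1) = 1` whenever `θ¹(p,q) > 0`. [cite: Grimmett2006, Thm. (5.99) p. 122] -/
theorem rcLimit_true_exactlyOneInfCluster_eq_one (hp : p ∈ Set.Icc (0 : ℝ) 1) (hq : 1 ≤ q)
    (hθ : 0 < thetaWired d p q) : rcLimit d true p q (exactlyOneInfCluster (Site d)) = 1 :=
  (isBoxLimit_rcLimit true hp hq).measure_exactlyOneInfCluster_eq_one_of_thetaWired_pos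
    ((isBoxLimit_rcLimit true hp hq).fkGibbs hp hq) hp hq hθ

/-- `θ⁰(p,q)² ≤ φ⁰_{p,q}(x ↔ y)`. [cite: Grimmett2006, proof of Thm. (5.17), eq. (5.32), p. 107] -/
theorem thetaFree_sq_le_rcLimit_real_openConn (hp : p ∈ Set.Icc (0 : ℝ) 1) (hq : 1 ≤ q)
    (x y : Site d) : thetaFree d p q ^ 2 ≤ (rcLimit d false p q).real (openConn x y) :=
  (isBoxLimit_rcLimit false hp hq).thetaFree_sq_le_real_openConn
    ((isBoxLimit_rcLimit false hp hq).fkGibbs hp hq) hp hq x y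

/-- `θ¹(p,q)² ≤ φ¹_{p,q}(x ↔ y)`. [cite: Grimmett2006, proof of Thm. (5.17), eq. (5.32), p. 107] -/
theorem thetaWired_sq_le_rcLimit_real_openConn (hp : p ∈ Set.Icc (0 : ℝ) 1) (hq : 1 ≤ q)
    (x y : Site d) : thetaWired d p q ^ 2 ≤ (rcLimit d true p q).real (openConn x y) :=
  (isBoxLimit_rcLimit true hp hq).thetaWired_sq_le_real_openConn
    ((isBoxLimit_rcLimit true hp hq).fkGibbs hp hq) hp hq x y

/-- **Grimmett 2006, Prop. (5.12) for `rcLimit`**: `φ^b_{Λ_n,p,q}(x ↔ y) → φ^b_{p,q}(x ↔ y)`.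
[cite: Grimmett2006, Prop. (5.12) p. 100] -/
theorem rcBoxLaw_real_openConn_tendsto_rcLimit (b : Bool) {p q : ℝ} (hp : p ∈ Set.Icc (0 : ℝ) 1)
    (hq : 1 ≤ q) (x y : Site d) :
    Tendsto (fun n => (rcBoxLaw d b p q n).real (openConn x y)) atTop
      (𝓝 ((rcLimit d b p q).real (openConn x y))) :=
  (isBoxLimit_rcLimit b hp hq).rcBoxLaw_real_openConn_tendsto
    ((isBoxLimit_rcLimit b hp hq).fkGibbs hp hq) hp hq x y

/-- **Grimmett 2006, eq. (5.32) for `rcLimit`**: `φ^b_{p,q}(0 ↔ u) → φ^b_{p,q}(0 ↔ ∞)²` as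
`|u| → ∞` (`0 ≤ p ≤ 1`, `q ≥ 1`, both `b`). [cite: Grimmett2006, Thm. (5.17), proof of eq. (5.32), p. 107] -/
theorem rcLimit_tendsto_real_openConn_cofinite (b : Bool) {p q : ℝ} (hp : p ∈ Set.Icc (0 : ℝ) 1)
    (hq : 1 ≤ q) :
    Tendsto (fun u : Site d => (rcLimit d b p q).real (openConn (0 : Site d) u)) cofinite
      (𝓝 ((rcLimit d b p q).real (percolatesAt (0 : Site d)) ^ 2)) :=
  (isBoxLimit_rcLimit b hp hq).tendsto_real_openConn_cofinite
    ((isBoxLimit_rcLimit b hp hq).fkGibbs hp hq)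
    (fun v => (isBoxLimit_rcLimit b hp hq).measurePreserving_relabel_shift hp hq v) hp
    (one_pos.trans_le hq) (ae_numInfiniteClusters_le_one_rcLimit b hp hq)

/-- (5.32) in `θ`-notation, free: `φ⁰_{p,q}(0 ↔ u) → θ⁰(p,q)²`. [cite: Grimmett2006, Thm. (5.17), eq. (5.32), p. 107] -/
theorem rcLimit_false_tendsto_real_openConn_thetaFree_sq (hp : p ∈ Set.Icc (0 : ℝ) 1) (hq : 1 ≤ q) :
    Tendsto (fun u : Site d => (rcLimit d false p q).real (openConn (0 : Site d) u)) cofinite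
      (𝓝 (thetaFree d p q ^ 2)) := by
  rw [← (isBoxLimit_rcLimit false hp hq).real_percolatesAt_eq_thetaFree hp hq]
  exact rcLimit_tendsto_real_openConn_cofinite false hp hq

/-- (5.32) in `θ`-notation, wired: `φ¹_{p,q}(0 ↔ u) → θ¹(p,q)²`. [cite: Grimmett2006, Thm. (5.17), eq. (5.32), p. 107] -/
theorem rcLimit_true_tendsto_real_openConn_thetaWired_sq (hp : p ∈ Set.Icc (0 : ℝ) 1) (hq : 1 ≤ q) :
    Tendsto (fun u : Site d => (rcLimit d true p q).real (openConn (0 : Site d) u)) cofinite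
      (𝓝 (thetaWired d p q ^ 2)) := by
  rw [← (isBoxLimit_rcLimit true hp hq).real_percolatesAt_eq_thetaWired hp hq]
  exact rcLimit_tendsto_real_openConn_cofinite true hp hq

/-! ## v2 (append): ergodicity of `φ^b_{p,q}` hypothesis-free, and the remaining Thm. (4.33)(c) / (5.99)
consequences for `rcLimit d b p q` — Grimmett 2006, Thm. (4.19)(d), Cor. (4.23), Thm. (4.33)(c), Thm. (5.99). -/

/-! ### Ergodicity of `φ^b_{p,q}`, hypothesis-free (Grimmett 2006, Thm. (4.19)(d), Cor. (4.23)) -/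

/-- **Grimmett 2006, Cor. (4.23) for every box limit, hypothesis-free**: `φ^b_{p,q}` is mixing on local
events along `cofinite` — `P(A ∩ τ_v⁻¹ B) → P(A) P(B)` as `|v| → ∞` (`0 ≤ p ≤ 1`, `q ≥ 1`), the DLR sandwich
and translation invariance being supplied by `IsBoxLimit.fkGibbs` / `IsBoxLimit.measurePreserving_relabel_shift`.
[cite: Grimmett2006, Cor. (4.23) p. 80] -/
theorem IsBoxLimit.tendsto_real_inter_preimage_shift_cofinite' (hP : IsBoxLimit d b p q P)
    (hp : p ∈ Set.Icc (0 : ℝ) 1) (hq : 1 ≤ q) {A B : Set (BondConfig (Site d))}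
    (hA : IsLocalEvent A) (hB : IsLocalEvent B) :
    Tendsto (fun v : Site d => P.real (A ∩ BondConfig.relabel (sym2Equiv (Site.shift v)) ⁻¹' B))
      cofinite (𝓝 (P.real A * P.real B)) :=
  hP.tendsto_real_inter_preimage_shift_cofinite (hP.fkGibbs hp hq)
    (hP.measurePreserving_relabel_shift hp hq) hp (one_pos.trans_le hq) hA hB

/-- **Translation-invariant events are trivial under every box limit `φ^b_{p,q}`** (`0 ≤ p ≤ 1`,
`q ≥ 1`, every `d`; ergodicity in the sense of the invariant σ-field — Grimmett 2006, Thm. (4.19)(d) /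
Thm. (4.33)(c) via Cor. (4.23)); hypothesis-free.  In dimension `0` the limit is the point mass at `∅`.
[cite: Grimmett2006, Thm. (4.19)(d) p. 76 and Cor. (4.23) p. 80] -/
theorem IsBoxLimit.measure_eq_zero_or_one_of_forall_preimage_shift_eq' (hP : IsBoxLimit d b p q P)
    (hp : p ∈ Set.Icc (0 : ℝ) 1) (hq : 1 ≤ q) {S : Set (BondConfig (Site d))} (hS : MeasurableSet S)
    (hSinv : ∀ v : Site d, BondConfig.relabel (sym2Equiv (Site.shift v)) ⁻¹' S = S) :
    P S = 0 ∨ P S = 1 := by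
  have hq0 : 0 < q := one_pos.trans_le hq
  rcases Nat.eq_zero_or_pos d with hd | hd
  · haveI := hP.isProbabilityMeasure
    exact measure_eq_zero_or_one_of_ae_eq_empty
      (ae_eq_empty_of_ae_subset_edgeSet_of_eq_zero hd (hP.ae_subset_edgeSet hp hq0)) hS
  · exact hP.measure_eq_zero_or_one_of_forall_preimage_shift_eq (hP.fkGibbs hp hq)
      (hP.measurePreserving_relabel_shift hp hq) hp hq0 hd hS hSinv

/-- **Grimmett 2006, Cor. (4.23) for `rcLimit d b p q`**: mixing on local events along `cofinite`.
[cite: Grimmett2006, Cor. (4.23) p. 80] -/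
theorem rcLimit_tendsto_real_inter_preimage_shift_cofinite (b : Bool) {p q : ℝ}
    (hp : p ∈ Set.Icc (0 : ℝ) 1) (hq : 1 ≤ q) {A B : Set (BondConfig (Site d))}
    (hA : IsLocalEvent A) (hB : IsLocalEvent B) :
    Tendsto (fun v : Site d =>
        (rcLimit d b p q).real (A ∩ BondConfig.relabel (sym2Equiv (Site.shift v)) ⁻¹' B))
      cofinite (𝓝 ((rcLimit d b p q).real A * (rcLimit d b p q).real B)) :=
  (isBoxLimit_rcLimit b hp hq).tendsto_real_inter_preimage_shift_cofinite' hp hq hA hB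

/-- **Zero–one law for translation-invariant events under `rcLimit d b p q`** (`0 ≤ p ≤ 1`, `q ≥ 1`,
every `d`, both boundary conditions). [cite: Grimmett2006, Thm. (4.19)(d) p. 76 and Cor. (4.23) p. 80] -/
theorem rcLimit_measure_eq_zero_or_one_of_forall_preimage_shift_eq (b : Bool) {p q : ℝ}
    (hp : p ∈ Set.Icc (0 : ℝ) 1) (hq : 1 ≤ q) {S : Set (BondConfig (Site d))} (hS : MeasurableSet S)
    (hSinv : ∀ v : Site d, BondConfig.relabel (sym2Equiv (Site.shift v)) ⁻¹' S = S) :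
    rcLimit d b p q S = 0 ∨ rcLimit d b p q S = 1 :=
  (isBoxLimit_rcLimit b hp hq).measure_eq_zero_or_one_of_forall_preimage_shift_eq' hp hq hS hSinv

/-! ### The remaining uniqueness consequences for `rcLimit d b p q` (Grimmett 2006, Thm. (4.33)(c), (5.99)) -/

/-- `rcLimit d b p q`-a.s. all sites in infinite clusters are connected to each other.
[cite: Grimmett2006, Thm. (4.33)(c) p. 79] -/
theorem rcLimit_ae_forall_mem_openConn_of_percolatesAt (b : Bool) {p q : ℝ}
    (hp : p ∈ Set.Icc (0 : ℝ) 1) (hq : 1 ≤ q) :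
    ∀ᵐ ω ∂(rcLimit d b p q), ∀ x y, ω ∈ percolatesAt x → ω ∈ percolatesAt y → ω ∈ openConn x y :=
  (isBoxLimit_rcLimit b hp hq).ae_forall_mem_openConn_of_percolatesAt
    ((isBoxLimit_rcLimit b hp hq).fkGibbs hp hq) hp hq

/-- `φ^b_{p,q}(x ↔ ∞) · φ^b_{p,q}(y ↔ ∞) ≤ φ^b_{p,q}(x ↔ y)` for `rcLimit d b p q`.
[cite: Grimmett2006, proof of Thm. (5.17), eq. (5.32), p. 107] -/
theorem rcLimit_real_percolatesAt_mul_le_real_openConn (b : Bool) {p q : ℝ}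
    (hp : p ∈ Set.Icc (0 : ℝ) 1) (hq : 1 ≤ q) (x y : Site d) :
    (rcLimit d b p q).real (percolatesAt x) * (rcLimit d b p q).real (percolatesAt y) ≤
      (rcLimit d b p q).real (openConn x y) :=
  (isBoxLimit_rcLimit b hp hq).real_percolatesAt_mul_le_real_openConn
    ((isBoxLimit_rcLimit b hp hq).fkGibbs hp hq) hp hq x y

/-- **Zero–one law for the existence of an infinite cluster under `rcLimit d b p q`**:
`ψ^b = φ^b_{p,q}(∃ x, x ↔ ∞) ∈ {0,1}`. [cite: Grimmett2006, Thm. (4.33)(c) with Cor. (4.23), pp. 78–80] -/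
theorem rcLimit_measure_setOf_exists_percolatesAt_eq_zero_or_one (b : Bool) {p q : ℝ}
    (hp : p ∈ Set.Icc (0 : ℝ) 1) (hq : 1 ≤ q) :
    rcLimit d b p q {ω | ∃ x : Site d, ω ∈ percolatesAt x} = 0 ∨
      rcLimit d b p q {ω | ∃ x : Site d, ω ∈ percolatesAt x} = 1 :=
  (isBoxLimit_rcLimit b hp hq).measure_setOf_exists_percolatesAt_eq_zero_or_one
    ((isBoxLimit_rcLimit b hp hq).fkGibbs hp hq) hp hq

/-- `ψ^b = 0 ↔ φ^b_{p,q}(0 ↔ ∞) = 0` for `rcLimit d b p q`. [cite: Grimmett2006, Thm. (5.99) p. 122] -/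
theorem rcLimit_measure_setOf_exists_percolatesAt_eq_zero_iff (b : Bool) {p q : ℝ}
    (hp : p ∈ Set.Icc (0 : ℝ) 1) (hq : 1 ≤ q) :
    rcLimit d b p q {ω | ∃ x : Site d, ω ∈ percolatesAt x} = 0 ↔
      rcLimit d b p q (percolatesAt (0 : Site d)) = 0 :=
  (isBoxLimit_rcLimit b hp hq).measure_setOf_exists_percolatesAt_eq_zero_iff
    ((isBoxLimit_rcLimit b hp hq).fkGibbs hp hq) hp hq

/-- `ψ^b = 1 ↔ φ^b_{p,q}(0 ↔ ∞) > 0` for `rcLimit d b p q`. [cite: Grimmett2006, Thm. (5.99) p. 122] -/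
theorem rcLimit_measure_setOf_exists_percolatesAt_eq_one_iff (b : Bool) {p q : ℝ}
    (hp : p ∈ Set.Icc (0 : ℝ) 1) (hq : 1 ≤ q) :
    rcLimit d b p q {ω | ∃ x : Site d, ω ∈ percolatesAt x} = 1 ↔
      0 < (rcLimit d b p q).real (percolatesAt (0 : Site d)) :=
  (isBoxLimit_rcLimit b hp hq).measure_setOf_exists_percolatesAt_eq_one_iff
    ((isBoxLimit_rcLimit b hp hq).fkGibbs hp hq) hp hq

/-- **Grimmett 2006, Thm. (5.99) for `rcLimit d b p q`**: `φ^b_{p,q}(I = 1) = 1 ↔ φ^b_{p,q}(0 ↔ ∞) > 0`.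
[cite: Grimmett2006, Thm. (5.99) p. 122] -/
theorem rcLimit_measure_exactlyOneInfCluster_eq_one_iff (b : Bool) {p q : ℝ}
    (hp : p ∈ Set.Icc (0 : ℝ) 1) (hq : 1 ≤ q) :
    rcLimit d b p q (exactlyOneInfCluster (Site d)) = 1 ↔
      0 < (rcLimit d b p q).real (percolatesAt (0 : Site d)) :=
  (isBoxLimit_rcLimit b hp hq).measure_exactlyOneInfCluster_eq_one_iff
    ((isBoxLimit_rcLimit b hp hq).fkGibbs hp hq) hp hq

/-- `φ⁰_{p,q}(I = 1) = 1 ↔ θ⁰(p,q) > 0` for `rcLimit d false p q`. [cite: Grimmett2006, Thm. (5.99) p. 122] -/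
theorem rcLimit_false_exactlyOneInfCluster_eq_one_iff_thetaFree_pos (hp : p ∈ Set.Icc (0 : ℝ) 1)
    (hq : 1 ≤ q) : rcLimit d false p q (exactlyOneInfCluster (Site d)) = 1 ↔ 0 < thetaFree d p q :=
  (isBoxLimit_rcLimit false hp hq).measure_exactlyOneInfCluster_eq_one_iff_thetaFree_pos
    ((isBoxLimit_rcLimit false hp hq).fkGibbs hp hq) hp hq

/-- `φ¹_{p,q}(I = 1) = 1 ↔ θ¹(p,q) > 0` for `rcLimit d true p q`. [cite: Grimmett2006, Thm. (5.99) p. 122] -/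
theorem rcLimit_true_exactlyOneInfCluster_eq_one_iff_thetaWired_pos (hp : p ∈ Set.Icc (0 : ℝ) 1)
    (hq : 1 ≤ q) : rcLimit d true p q (exactlyOneInfCluster (Site d)) = 1 ↔ 0 < thetaWired d p q :=
  (isBoxLimit_rcLimit true hp hq).measure_exactlyOneInfCluster_eq_one_iff_thetaWired_pos
    ((isBoxLimit_rcLimit true hp hq).fkGibbs hp hq) hp hq

/-- **`N ≡ 0` a.s. or `N ≡ 1` a.s. under `rcLimit d b p q`** (number of infinite clusters).
[cite: Grimmett2006, Thm. (5.99) p. 122 (with Thm. (4.33)(c))] -/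
theorem rcLimit_ae_numInfiniteClusters_eq_zero_or_one (b : Bool) {p q : ℝ}
    (hp : p ∈ Set.Icc (0 : ℝ) 1) (hq : 1 ≤ q) :
    (∀ᵐ ω ∂(rcLimit d b p q), numInfiniteClusters ω = 0) ∨
      (∀ᵐ ω ∂(rcLimit d b p q), numInfiniteClusters ω = 1) :=
  (isBoxLimit_rcLimit b hp hq).ae_numInfiniteClusters_eq_zero_or_one
    ((isBoxLimit_rcLimit b hp hq).fkGibbs hp hq) hp hq

/-- `θ⁰(p,q) = 0` forces `rcLimit d false p q`-a.s. no infinite cluster. [cite: Grimmett2006, Thm. (5.99) p. 122] -/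
theorem rcLimit_false_ae_numInfiniteClusters_eq_zero_of_thetaFree_eq_zero (hp : p ∈ Set.Icc (0 : ℝ) 1)
    (hq : 1 ≤ q) (hθ : thetaFree d p q = 0) :
    ∀ᵐ ω ∂(rcLimit d false p q), numInfiniteClusters ω = 0 :=
  (isBoxLimit_rcLimit false hp hq).ae_numInfiniteClusters_eq_zero_of_thetaFree_eq_zero
    ((isBoxLimit_rcLimit false hp hq).fkGibbs hp hq) hp hq hθ

/-- `θ⁰(p,q) > 0` forces `rcLimit d false p q`-a.s. exactly one infinite cluster. [cite: Grimmett2006, Thm. (5.99) p. 122] -/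
theorem rcLimit_false_ae_numInfiniteClusters_eq_one_of_thetaFree_pos (hp : p ∈ Set.Icc (0 : ℝ) 1)
    (hq : 1 ≤ q) (hθ : 0 < thetaFree d p q) :
    ∀ᵐ ω ∂(rcLimit d false p q), numInfiniteClusters ω = 1 :=
  (isBoxLimit_rcLimit false hp hq).ae_numInfiniteClusters_eq_one_of_thetaFree_pos
    ((isBoxLimit_rcLimit false hp hq).fkGibbs hp hq) hp hq hθ

/-- `θ¹(p,q) = 0` forces `rcLimit d true p q`-a.s. no infinite cluster. [cite: Grimmett2006, Thm. (5.99) p. 122] -/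
theorem rcLimit_true_ae_numInfiniteClusters_eq_zero_of_thetaWired_eq_zero (hp : p ∈ Set.Icc (0 : ℝ) 1)
    (hq : 1 ≤ q) (hθ : thetaWired d p q = 0) :
    ∀ᵐ ω ∂(rcLimit d true p q), numInfiniteClusters ω = 0 :=
  (isBoxLimit_rcLimit true hp hq).ae_numInfiniteClusters_eq_zero_of_thetaWired_eq_zero
    ((isBoxLimit_rcLimit true hp hq).fkGibbs hp hq) hp hq hθ

/-- `θ¹(p,q) > 0` forces `rcLimit d true p q`-a.s. exactly one infinite cluster. [cite: Grimmett2006, Thm. (5.99) p. 122] -/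
theorem rcLimit_true_ae_numInfiniteClusters_eq_one_of_thetaWired_pos (hp : p ∈ Set.Icc (0 : ℝ) 1)
    (hq : 1 ≤ q) (hθ : 0 < thetaWired d p q) :
    ∀ᵐ ω ∂(rcLimit d true p q), numInfiniteClusters ω = 1 :=
  (isBoxLimit_rcLimit true hp hq).ae_numInfiniteClusters_eq_one_of_thetaWired_pos
    ((isBoxLimit_rcLimit true hp hq).fkGibbs hp hq) hp hq hθ

end Summit.CriticalPhenomena.PercolationContinuityZ3.Theorems.FK

end
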